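import Literature.RingTheory.KTheory.AdamsOperationsMul
import Literature.AlgebraicTopology.KTheory.ReducedSphereVanishing
import HarnessLib

/-!
# The Adams operations `ψ², ψ³` on `K⁰(X)` (topological layer)

`K⁰(X) = K₀(C(X, ℂ))` (`Basic.lean`), and `C(X, ℂ)` is a commutative `ℂ`-algebra, so the algebraic
Adams operations of `AdamsOperations*.lean` (Atiyah's cyclic power operations) give ring
endomorphisms **`psiK X k : K⁰(X) →+* K⁰(X)`** (`k = 2, 3`). This file records the properties
used in the Adams–Atiyah argument (Hatcher, *VBKT* Thm. 2.20 / proof of Thm. 2.19):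

* §1 `psiK`, **naturality** `f^* ∘ ψ^k = ψ^k ∘ f^*` (`pullback_psiK`, the pull-back ring map is
  a `ℂ`-algebra map), `ψ^k = id` on `K₀(ℂ)` (`psi_apply_complex`), hence **`ψ^k` preserves the
  rank at every point and the reduced groups** (`rankAt_psiK`, `psiK_mem_reduced`), the congruence
  `ψ²(x) - x² ∈ 2 K⁰(X)` and `ψ²ψ³ = ψ³ψ²` (re-exported);
* §2 **line bundles**: a class `[p]` of rank one everywhere satisfies `ψ^k[p] = [p]^k`
  (`psiK_of_eq_pow_of_rankAt_eq_one`; the idempotent is pointwise of rank one, hence all its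
  `2 × 2` minors vanish); in particular for the **Bott class** `γ` on `X × S²`:
  `ψ^k γ = γ^k` and **`ψ^k (γ - 1) = k (γ - 1)`** (`psiK_bottγ_sub_one`, using `(γ - 1)² = 0`).

Everything is proved; no named facts.

## References

* M. F. Atiyah, Power operations in `K`-theory, Quart. J. Math. 17 (1966) 165–193, §2.
  [Atiyah1966PowerOperations]
* A. Hatcher, *Vector Bundles and K-Theory* (v2.2, 2017), §2.3 Thm. 2.20 (properties of `ψ^k`:
  natural ring homomorphisms, `ψ^k(L) = L^k` for line bundles), Prop. 2.21. [HatcherVBKT2017]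
* J. F. Adams, M. F. Atiyah, `K`-theory and the Hopf invariant (1966). [AdamsAtiyah1966]
-/

noncomputable section

namespace Literature.AlgebraicTopology.KTheory

open Literature.RingTheory.KTheory Matrix Set TopologicalSpace

universe u v

/-! ### 1. `ψ^k` on `K⁰(X)`: naturality, ranks, reduced groups -/

section Psi

variable {X : Type u} [TopologicalSpace X] {Y : Type v} [TopologicalSpace Y]

/-- **The Adams operation `ψ^k : K⁰(X) → K⁰(X)`** (`k = 2, 3`), a ring endomorphism. [cite: HatcherVBKT2017, §2.3 Thm. 2.20] -/
def psiK (X : Type u) [TopologicalSpace X] (k : ℕ) [IsAdamsPrime k] : K0 X →+* K0 X := psiRingHom C(X, ℂ) k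

/-- Adams operations on K⁰(X) (Hatcher VBKT Thm 2.20). [folklore] -/
theorem psiK_apply (k : ℕ) [IsAdamsPrime k] (a : K0 X) : psiK X k a = psi C(X, ℂ) k a := rfl

/-- **Naturality of `ψ^k`.** [cite: HatcherVBKT2017, §2.3 Thm. 2.20] -/
theorem pullback_psiK (k : ℕ) [IsAdamsPrime k] (f : C(X, Y)) (a : K0 Y) : pullback f (psiK Y k a) = psiK X k (pullback f a) := by
  change KZero.map (ContinuousMap.compRightAlgHom ℂ ℂ f).toRingHom (psi C(Y, ℂ) k a) =
    psi C(X, ℂ) k (KZero.map (ContinuousMap.compRightAlgHom ℂ ℂ f).toRingHom a)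
  exact map_psi (ContinuousMap.compRightAlgHom ℂ ℂ f) k a

/-- **`ψ^k` is the identity on `K₀(ℂ) = ℤ`.** [cite: HatcherVBKT2017, §2.3 Thm. 2.20] -/
theorem psi_apply_complex (k : ℕ) [IsAdamsPrime k] (x : KZero ℂ) : psi ℂ k x = x := by
  have hx : x = ((KZero.rankRingEquiv (K := ℂ) x : ℤ) : KZero ℂ) := by
    apply (KZero.rankRingEquiv (K := ℂ)).injective
    rw [map_intCast]
    rfl
  rw [hx, ← psiRingHom_apply, map_intCast]

/-- **`ψ^k` preserves the rank at every point.** [cite: HatcherVBKT2017, §2.3 Thm. 2.20] -/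
theorem rankAt_psiK (k : ℕ) [IsAdamsPrime k] (x : X) (a : K0 X) : rankAt x (psiK X k a) = rankAt x a := by
  change KZero.rankEquiv (KZero.map (ContinuousMap.evalAlgHom ℂ ℂ x).toRingHom (psi C(X, ℂ) k a)) =
    KZero.rankEquiv (KZero.map (ContinuousMap.evalAlgHom ℂ ℂ x).toRingHom a)
  rw [map_psi (ContinuousMap.evalAlgHom ℂ ℂ x) k a, psi_apply_complex]

/-- **`ψ^k` preserves the reduced group.** [cite: HatcherVBKT2017, §2.3 Thm. 2.20] -/
theorem psiK_mem_reduced (k : ℕ) [IsAdamsPrime k] {x₀ : X} {a : K0 X} (ha : a ∈ Reduced X x₀) : psiK X k a ∈ Reduced X x₀ := by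
  rw [mem_reduced_iff, rankAt_psiK]; exact ha

/-- `ψ²(a) - a² ∈ 2 K⁰(X)`. [cite: AdamsAtiyah1966, §1] -/
theorem exists_psiK_two_sub_sq (a : K0 X) : ∃ y : K0 X, psiK X 2 a - a * a = 2 * y := exists_psi_two_sub_sq a

/-- `ψ² ψ³ = ψ³ ψ²` on `K⁰(X)`. [cite: AdamsAtiyah1966, §1] -/
theorem psiK_two_three_comm (a : K0 X) : psiK X 2 (psiK X 3 a) = psiK X 3 (psiK X 2 a) := psi_two_psi_three a

/-- `ψ^k` restricted to the reduced group. [cite: HatcherVBKT2017, §2.3 Thm. 2.20] -/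
def psiReduced (k : ℕ) [IsAdamsPrime k] (x₀ : X) : Reduced X x₀ →+ Reduced X x₀ :=
  ((psiK X k : K0 X →+* K0 X) : K0 X →+ K0 X).restrict (Reduced X x₀) |>.codRestrict (Reduced X x₀) fun a ↦ psiK_mem_reduced k a.2

/-- Adams operations on K⁰(X) (Hatcher VBKT Thm 2.20). [folklore] -/
@[simp] theorem coe_psiReduced (k : ℕ) [IsAdamsPrime k] (x₀ : X) (a : Reduced X x₀) : (psiReduced k x₀ a : K0 X) = psiK X k a := rfl

end Psi

/-! ### 2. Line bundles: classes of rank one -/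

section Line

variable {X : Type u} [TopologicalSpace X]

/-- An idempotent matrix over `ℂ` algebraically equivalent to the `1 × 1` identity is a line
element (it factors as column times row). [folklore] -/
theorem isLine_of_algEquivalent_one {ι : Type*} [Fintype ι] [DecidableEq ι] {R : Type*} [CommRing R] {M : Matrix ι ι R}
    (h : AlgEquivalent M (1 : Matrix (Fin 1) (Fin 1) R)) : IsLine M := by
  obtain ⟨x, y, hxy, -, -, -⟩ := h
  rw [← hxy]
  exact isLine_col_mul_row x y

/-- **An idempotent of rank one at every point is a line element** (all its `2 × 2` minors vanish
pointwise). [folklore] -/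
theorem isLine_of_rankAt_eq_one (p : Idem C(X, ℂ)) (h : ∀ x, rankAt x (KZero.of p) = 1) : IsLine p.mat := by
  intro r r' c c'
  ext x
  have hx : (p.map (evalRingHom x)).rank = 1 := by
    have h1 := h x
    rw [rankAt_of] at h1
    exact_mod_cast h1
  have halg : AlgEquivalent (p.mat.map (evalRingHom x)) (1 : Matrix (Fin 1) (Fin 1) ℂ) := Idem.equiv_iff.1 (Idem.rank_eq_iff.1 hx)
  have hl := isLine_of_algEquivalent_one halg r r' c c'
  simp only [Matrix.map_apply, evalRingHom_apply] at hl
  exact hl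

/-- **`ψ^k[p] = [p]^k` for a class of rank one everywhere** (`ψ^k` of a line bundle is its
`k`-th tensor power). [cite: HatcherVBKT2017, §2.3 Thm. 2.20] -/
theorem psiK_of_eq_pow_of_rankAt_eq_one (k : ℕ) [IsAdamsPrime k] (p : Idem C(X, ℂ)) (h : ∀ x, rankAt x (KZero.of p) = 1) :
    psiK X k (KZero.of p) = KZero.of p ^ k := by
  rw [psiK_apply, ← kc_mat, psi_kc_of_isLine k (isLine_of_rankAt_eq_one p h) p.isIdempotentElem]

variable [CompactSpace X] [T2Space X]

/-- The Bott class is represented by an idempotent of rank one everywhere. [cite: HusemollerFibreBundles1994, Ch. 11 Notation 2.7] -/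
theorem exists_bottγ_eq_of (X : Type u) [TopologicalSpace X] [CompactSpace X] [T2Space X] :
    ∃ p : Idem C(X × S2r, ℂ), bottγ X = KZero.of p := by
  classical
  obtain ⟨Q, hQ⟩ := exists_isClutchedGL ((zA : C(↥(pieceUp X ∩ pieceDn X), ℂ)) • (1 : Matrix (Fin 1) (Fin 1) C(↥(pieceUp X ∩ pieceDn X), ℂ)))
    (isUnit_smul_one isUnit_zA _)
  exact ⟨Idem.ofMatrix Q hQ.isIdempotentElem, hQ.of_ofMatrix_eq.symm⟩

/-- **`ψ^k γ = γ^k` for the Bott class.** [cite: HatcherVBKT2017, §2.3 Thm. 2.20] -/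
theorem psiK_bottγ (k : ℕ) [IsAdamsPrime k] : psiK (X × S2r) k (bottγ X) = bottγ X ^ k := by
  obtain ⟨p, hp⟩ := exists_bottγ_eq_of X
  rw [hp]
  exact psiK_of_eq_pow_of_rankAt_eq_one k p fun z ↦ by rw [← hp]; exact rankAt_bottγ z

/-- **`ψ^k (γ - 1) = k (γ - 1)`** (`(γ - 1)² = 0`, so `γ^k = 1 + k(γ - 1)`). [cite: HatcherVBKT2017, §2.3 Prop. 2.21] -/
theorem psiK_bottγ_sub_one (k : ℕ) [h : IsAdamsPrime k] : psiK (X × S2r) k (bottγ X - 1) = (k : K0 (X × S2r)) * (bottγ X - 1) := by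
  have hsq : bottγ X ^ 2 = 2 * bottγ X - 1 := eq_sub_of_add_eq (bottγ_sq_add_one (X := X))
  rw [map_sub, map_one, psiK_bottγ]
  rcases h.out with rfl | rfl
  · push_cast; linear_combination hsq
  · push_cast; linear_combination (bottγ X + 2) * hsq

end Line

end Literature.AlgebraicTopology.KTheory

end
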